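import Literature.Barriers.CriticalPhenomena.GaussianDominationRoute
import Mathlib.Algebra.Group.EvenFunction
import Mathlib.Analysis.SpecialFunctions.Trigonometric.Basic
import HarnessLib

/-!
# Diagrammatic estimates for the lace expansion: the abstract ladder bounds (Slade 2006, §4.2)

Infrastructure for the convergence proof of the lace expansion (Theorem 5.8 of Slade 2006,
`Literature.Barriers.CriticalPhenomena.Slade2006_thm58`). This file contains the part of the proof
of the diagrammatic estimates **Theorem 4.1** that is pure analysis on `ℤ^d`, for ARBITRARY
non-negative even functions (the self-avoiding-walk input — Proposition 4.2, bounding the lace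
coefficients `π_m^{(N)}` by such diagrams — is supplied separately). Everything is valued in
`ℝ≥0∞`, so that no summability hypothesis is ever needed (Slade: "for all `z ≥ 0`").

* `econv` (convolution on `ℤ^d`, (1.4)), `esup` (the sup norm `‖·‖_∞`);
* `ladder f M` — the function `(ℋ'_M ℳ_M ⋯ ℋ'_1 ℳ_1) f₀` of (4.36)/(4.41) built from a list of
  factors `f₀, f₁, f₂, …` (`ℳ_j` = multiplication by `f_{2j-1}`, `ℋ'_j` = convolution with `f_{2j}`);
* **Lemma 4.6** (`esup_ladder_le`): `‖ladder f M‖_∞ ≤ ‖f_k‖_∞ ∏ ‖f_j * f_{j'}‖_∞`, the product over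
  the consecutive disjoint pairs of `{0,…,2M} ∖ {k}`, for every `k ≤ 2M`;
* `diagram f N x y` — the two-point diagram `P^{(N)}(x,y)` of (4.16)–(4.21) with general factors
  (`P^{(2)}(x,y) = f₀(x) f₁(-x) f₂(y)`, `P^{(N)}(x,y) = Σ_u P^{(N-1)}(u,x) f_{2N-3}(u-x) f_{2N-2}(y-u)`),
  and **Lemma 4.4** (`tsum_diagram_eq_ladder`): `Σ_x P^{(N)}(x, x+y) = ladder f (N-1) y`;
* the consequences in the shape of Theorem 4.1: **(4.9)** `Σ_x P^{(N)}(x,x) ≤ ‖f₀‖_∞ ∏_{j=1}^{N-1}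
  ‖f_{2j-1} * f_{2j}‖_∞` (`tsum_diagram_le`) and the `[1 - cos(k·x)]`-weighted **(4.10)**
  (`tsum_cosWeight_mul_diagram_le`), where — a harmless weakening of (4.51), sufficient for (5.47) —
  the weight is distributed along the pieces `I₃, I₇, I₁₁, …` of (4.46) by iterating
  `1 - cos(s+t) ≤ 2[1 - cos s] + 2[1 - cos t]`, giving the constant `2^{⌊N/2⌋}` in place of `(N+1)`.

For the self-avoiding walk the factors are `f = (H_z, H_z, G_z, H_z, G_z, …)` (Fig. 4.2).
-/

noncomputable section

open Filter Real Finset Function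
open Literature.Probability.LatticeModels
open scoped BigOperators ENNReal Topology

namespace Literature.Barriers.CriticalPhenomena

namespace LaceExpansion

variable {d : ℕ}

/-! ### Convolution and the sup norm in `ℝ≥0∞` -/

/-- Convolution `(f * g)(x) = Σ_y f(y) g(x - y)` of `[0,∞]`-valued functions on `ℤ^d`.
[cite: Slade2006LaceExpansion, eq. (1.4)] -/
def econv (f g : Site d → ℝ≥0∞) (x : Site d) : ℝ≥0∞ := ∑' y, f y * g (x - y)

/-- The sup norm `‖f‖_∞ = sup_x f(x)` of a `[0,∞]`-valued function on `ℤ^d`.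
[cite: Slade2006LaceExpansion, §4.1] -/
def esup (f : Site d → ℝ≥0∞) : ℝ≥0∞ := ⨆ x, f x

/-- `f(x) ≤ ‖f‖_∞`. [folklore] -/
theorem le_esup (f : Site d → ℝ≥0∞) (x : Site d) : f x ≤ esup f := le_iSup f x

/-- `‖f‖_∞ ≤ C` iff `f ≤ C` pointwise. [folklore] -/
theorem esup_le_iff {f : Site d → ℝ≥0∞} {C : ℝ≥0∞} : esup f ≤ C ↔ ∀ x, f x ≤ C := iSup_le_iff

/-- The sup norm is monotone. [folklore] -/
theorem esup_mono {f g : Site d → ℝ≥0∞} (h : ∀ x, f x ≤ g x) : esup f ≤ esup g :=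
  iSup_mono h

/-- Convolution is commutative. [folklore] -/
theorem econv_comm (f g : Site d → ℝ≥0∞) (x : Site d) : econv f g x = econv g f x := by
  unfold econv
  rw [← (Equiv.subLeft x).tsum_eq (fun y => g y * f (x - y))]
  refine tsum_congr fun y => ?_
  simp [Equiv.subLeft, mul_comm]

/-- Convolution is monotone in both arguments. [folklore] -/
theorem econv_mono {f f' g g' : Site d → ℝ≥0∞} (hf : ∀ x, f x ≤ f' x) (hg : ∀ x, g x ≤ g' x) :
    ∀ x, econv f g x ≤ econv f' g' x :=
  fun _ => ENNReal.tsum_le_tsum fun y => mul_le_mul' (hf y) (hg _)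

/-- Convolution is associative. [folklore] -/
theorem econv_assoc (f g h : Site d → ℝ≥0∞) (x : Site d) :
    econv (econv f g) h x = econv f (econv g h) x := by
  unfold econv
  calc ∑' y, (∑' u, f u * g (y - u)) * h (x - y)
      = ∑' y, ∑' u, f u * g (y - u) * h (x - y) := by
        refine tsum_congr fun y => ?_; rw [← ENNReal.tsum_mul_right]
    _ = ∑' u, ∑' y, f u * g (y - u) * h (x - y) := ENNReal.tsum_comm
    _ = ∑' u, f u * ∑' v, g v * h (x - u - v) := by
        refine tsum_congr fun u => ?_
        rw [← ENNReal.tsum_mul_left, ← (Equiv.addRight u).tsum_eq (fun y => f u * g (y - u) * h (x - y))]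
        refine tsum_congr fun v => ?_
        simp only [Equiv.coe_addRight, add_sub_cancel_right, mul_assoc]
        congr 3
        abel

/-- The convolution of two even functions is even. [folklore] -/
theorem even_econv {f g : Site d → ℝ≥0∞} (hf : Function.Even f) (hg : Function.Even g) :
    Function.Even (econv f g) := by
  intro x
  unfold econv
  rw [← (Equiv.neg (Site d)).tsum_eq (fun y => f y * g (-x - y))]
  refine tsum_congr fun y => ?_
  simp only [Equiv.neg_apply, hf y]
  congr 1
  rw [← hg]
  congr 1
  abel

/-- The product of two even functions is even. [folklore] -/
theorem even_mul {f g : Site d → ℝ≥0∞} (hf : Function.Even f) (hg : Function.Even g) :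
    Function.Even fun x => f x * g x := fun x => by simp only [hf x, hg x]

/-- `(f * g)(y) ≤ ‖f‖_∞ Σ g`-type bound: pulling a bounded factor out of a sum. [folklore] -/
theorem tsum_mul_le_esup_mul (f g : Site d → ℝ≥0∞) : ∑' x, f x * g x ≤ esup f * ∑' x, g x := by
  rw [← ENNReal.tsum_mul_left]
  exact ENNReal.tsum_le_tsum fun x => mul_le_mul' (le_esup f x) le_rfl

/-- `Σ_x F(x) f(x) = (F * f)(0)` for even `f`. [cite: Slade2006LaceExpansion, eq. (4.42)] -/
theorem tsum_mul_eq_econv_zero (F f : Site d → ℝ≥0∞) (hf : Function.Even f) :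
    ∑' x, F x * f x = econv F f 0 := by
  unfold econv
  exact tsum_congr fun x => by rw [zero_sub, hf x]

/-! ### The ladder `(ℋ'_M ℳ_M ⋯ ℋ'_1 ℳ_1) f₀` and Lemma 4.6 -/

/-- The ladder function `F_M = (ℋ'_M ℳ_M ⋯ ℋ'_1 ℳ_1) f₀` of (4.41): `F₀ = f₀`,
`F_M = (f_{2M-1} · F_{M-1}) * f_{2M}` (multiplication by `f_{2M-1}`, then convolution with `f_{2M}`).
[cite: Slade2006LaceExpansion, Lemma 4.6, eq. (4.41)] -/
def ladder (f : ℕ → Site d → ℝ≥0∞) : ℕ → Site d → ℝ≥0∞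
  | 0 => f 0
  | M + 1 => econv (fun x => f (2 * M + 1) x * ladder f M x) (f (2 * M + 2))

/-- `ladder f M` depends only on `f₀, …, f_{2M}`. [folklore] -/
theorem ladder_congr {f g : ℕ → Site d → ℝ≥0∞} :
    ∀ M, (∀ j ≤ 2 * M, f j = g j) → ladder f M = ladder g M
  | 0, h => h 0 le_rfl
  | M + 1, h => by
    simp only [ladder]
    rw [ladder_congr M fun j hj => h j (by omega), h (2 * M + 1) (by omega), h (2 * M + 2) (by omega)]

/-- The ladder of even factors is even. [folklore] -/
theorem even_ladder {f : ℕ → Site d → ℝ≥0∞} (hf : ∀ j, Function.Even (f j)) :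
    ∀ M, Function.Even (ladder f M)
  | 0 => hf 0
  | M + 1 => even_econv (even_mul (hf _) (even_ladder hf M)) (hf _)

/-- Replacing the last convolution factor: `ladder (update f (2M) g) M = …` recomputed. For `M = 0`
this is `g`; for `M = M'+1` it is `(f_{2M'+1} F_{M'}) * g`. [folklore] -/
theorem ladder_update_last (f : ℕ → Site d → ℝ≥0∞) (g : Site d → ℝ≥0∞) :
    ∀ M, ladder (Function.update f (2 * M) g) M =
      match M with
      | 0 => g
      | M' + 1 => econv (fun x => f (2 * M' + 1) x * ladder f M' x) g
  | 0 => by simp [ladder]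
  | M' + 1 => by
    simp only [ladder]
    rw [show 2 * (M' + 1) = 2 * M' + 2 by ring, Function.update_self,
      Function.update_of_ne (by omega), ladder_congr M' fun j hj => Function.update_of_ne (by omega) _ _]

/-- Convolving the ladder with one more factor amounts to replacing its last factor `f_{2M}` by
`f_{2M} * h` (associativity, (4.43)). [cite: Slade2006LaceExpansion, eq. (4.43)] -/
theorem econv_ladder (f : ℕ → Site d → ℝ≥0∞) (h : Site d → ℝ≥0∞) :
    ∀ M x, econv (ladder f M) h x = ladder (Function.update f (2 * M) (econv (f (2 * M)) h)) M x
  | 0, x => by rw [ladder_update_last]; rfl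
  | M' + 1, x => by
    rw [ladder_update_last]
    simp only [ladder]
    rw [show 2 * (M' + 1) = 2 * M' + 2 by ring]
    exact econv_assoc _ _ _ x

/-- The index of the `p`-th element of `{0, 1, 2, …} ∖ {k}`. [folklore] -/
def skipIdx (k p : ℕ) : ℕ := if p < k then p else p + 1

/-- The right-hand side of Lemma 4.6: `‖f_k‖_∞ ∏_{j<M} ‖f_{e(2j)} * f_{e(2j+1)}‖_∞`, the product over
the consecutive disjoint pairs of `{0,…,2M} ∖ {k}` (`e = skipIdx k`).
[cite: Slade2006LaceExpansion, Lemma 4.6, eq. (4.41)] -/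
def fanBound (f : ℕ → Site d → ℝ≥0∞) (k M : ℕ) : ℝ≥0∞ :=
  esup (f k) * ∏ j ∈ range M, esup (econv (f (skipIdx k (2 * j))) (f (skipIdx k (2 * j + 1))))

/-- **Lemma 4.6** (Slade 2006): for non-negative even `f₀, …, f_{2M}` and any `k ≤ 2M`,
`‖(ℋ'_M ℳ_M ⋯ ℋ'_1 ℳ_1) f₀‖_∞ ≤ ‖f_k‖_∞ ∏ ‖f_j * f_{j'}‖_∞`, the product over the consecutive
disjoint pairs `j, j'` of `{0,…,2M} ∖ {k}`. [cite: Slade2006LaceExpansion, Lemma 4.6] -/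
theorem esup_ladder_le :
    ∀ (M : ℕ) (f : ℕ → Site d → ℝ≥0∞), (∀ j, Function.Even (f j)) → ∀ k ≤ 2 * M,
      esup (ladder f M) ≤ fanBound f k M
  | 0, f, _, k, hk => by
    obtain rfl : k = 0 := by omega
    simp [fanBound, ladder]
  | M + 1, f, hf, k, hk => by
    -- the three cases of (4.42): where does the sup norm go?
    rcases Nat.lt_or_ge k (2 * M + 1) with hk1 | hk1
    · -- (i) `k ≤ 2M`: sup norm on `F_M`, then the induction hypothesis
      have IH := esup_ladder_le M f hf k (by omega)
      have step : esup (ladder f (M + 1)) ≤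
          esup (ladder f M) * esup (econv (f (2 * M + 1)) (f (2 * M + 2))) := by
        rw [esup_le_iff]
        intro y
        simp only [ladder, econv]
        calc ∑' x, f (2 * M + 1) x * ladder f M x * f (2 * M + 2) (y - x)
            = ∑' x, ladder f M x * (f (2 * M + 1) x * f (2 * M + 2) (y - x)) :=
              tsum_congr fun x => by ring
          _ ≤ esup (ladder f M) * ∑' x, f (2 * M + 1) x * f (2 * M + 2) (y - x) :=
              tsum_mul_le_esup_mul _ _
          _ ≤ _ := mul_le_mul' le_rfl (le_esup (econv (f (2 * M + 1)) (f (2 * M + 2))) y)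
      refine step.trans ?_
      rw [fanBound, prod_range_succ, ← mul_assoc]
      refine mul_le_mul' IH (le_of_eq ?_)
      simp only [skipIdx]
      rw [if_neg (by omega), if_neg (by omega)]
    · rcases Nat.lt_or_ge k (2 * M + 2) with hk2 | hk2
      · -- (ii) `k = 2M+1`: sup norm on `f_{2M+1}`, convolve `F_M` with `f_{2M+2}`
        obtain rfl : k = 2 * M + 1 := by omega
        set f' := Function.update f (2 * M) (econv (f (2 * M)) (f (2 * M + 2))) with hf'
        have hf'e : ∀ j, Function.Even (f' j) := by
          intro j
          by_cases hj : j = 2 * M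
          · subst hj; rw [hf', Function.update_self]; exact even_econv (hf _) (hf _)
          · rw [hf', Function.update_of_ne hj]; exact hf j
        have IH := esup_ladder_le M f' hf'e (2 * M) le_rfl
        have step : esup (ladder f (M + 1)) ≤ esup (f (2 * M + 1)) * esup (ladder f' M) := by
          rw [esup_le_iff]
          intro y
          simp only [ladder, econv]
          calc ∑' x, f (2 * M + 1) x * ladder f M x * f (2 * M + 2) (y - x)
              = ∑' x, f (2 * M + 1) x * (ladder f M x * f (2 * M + 2) (y - x)) :=
                tsum_congr fun x => by ring
            _ ≤ esup (f (2 * M + 1)) * ∑' x, ladder f M x * f (2 * M + 2) (y - x) :=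
                tsum_mul_le_esup_mul _ _
            _ = esup (f (2 * M + 1)) * ladder f' M y := by
                congr 1
                exact econv_ladder f (f (2 * M + 2)) M y
            _ ≤ _ := mul_le_mul' le_rfl (le_esup _ y)
        refine step.trans ?_
        rw [fanBound]
        refine mul_le_mul' le_rfl (IH.trans (le_of_eq ?_))
        rw [fanBound, prod_range_succ, hf', Function.update_self, mul_comm]
        congr 1
        · refine prod_congr rfl fun j hj => ?_
          rw [mem_range] at hj
          simp only [skipIdx, if_pos (show 2 * j < 2 * M by omega),
            if_pos (show 2 * j + 1 < 2 * M by omega), if_pos (show 2 * j < 2 * M + 1 by omega),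
            if_pos (show 2 * j + 1 < 2 * M + 1 by omega)]
          rw [Function.update_of_ne (by omega), Function.update_of_ne (by omega)]
        · simp only [skipIdx, if_pos (show 2 * M < 2 * M + 1 by omega), lt_irrefl, if_false]
      · -- (iii) `k = 2M+2`: sup norm on `f_{2M+2}`, use `Σ_x F_M f_{2M+1} = (F_M * f_{2M+1})(0)`
        obtain rfl : k = 2 * M + 2 := by omega
        set f' := Function.update f (2 * M) (econv (f (2 * M)) (f (2 * M + 1))) with hf'
        have hf'e : ∀ j, Function.Even (f' j) := by
          intro j
          by_cases hj : j = 2 * M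
          · subst hj; rw [hf', Function.update_self]; exact even_econv (hf _) (hf _)
          · rw [hf', Function.update_of_ne hj]; exact hf j
        have IH := esup_ladder_le M f' hf'e (2 * M) le_rfl
        have step : esup (ladder f (M + 1)) ≤ esup (f (2 * M + 2)) * esup (ladder f' M) := by
          rw [esup_le_iff]
          intro y
          simp only [ladder, econv]
          calc ∑' x, f (2 * M + 1) x * ladder f M x * f (2 * M + 2) (y - x)
              = ∑' x, f (2 * M + 2) (y - x) * (ladder f M x * f (2 * M + 1) x) :=
                tsum_congr fun x => by ring
            _ ≤ esup (fun x => f (2 * M + 2) (y - x)) * ∑' x, ladder f M x * f (2 * M + 1) x :=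
                tsum_mul_le_esup_mul _ _
            _ ≤ esup (f (2 * M + 2)) * ladder f' M 0 := by
                refine mul_le_mul' (iSup_le fun x => le_esup _ _) (le_of_eq ?_)
                rw [tsum_mul_eq_econv_zero _ _ (hf _)]
                exact econv_ladder f (f (2 * M + 1)) M 0
            _ ≤ _ := mul_le_mul' le_rfl (le_esup _ 0)
        refine step.trans ?_
        rw [fanBound]
        refine mul_le_mul' le_rfl (IH.trans (le_of_eq ?_))
        rw [fanBound, prod_range_succ, hf', Function.update_self, mul_comm]
        congr 1
        · refine prod_congr rfl fun j hj => ?_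
          rw [mem_range] at hj
          simp only [skipIdx, if_pos (show 2 * j < 2 * M by omega),
            if_pos (show 2 * j + 1 < 2 * M by omega), if_pos (show 2 * j < 2 * M + 2 by omega),
            if_pos (show 2 * j + 1 < 2 * M + 2 by omega)]
          rw [Function.update_of_ne (by omega), Function.update_of_ne (by omega)]
        · simp only [skipIdx, if_pos (show 2 * M < 2 * M + 2 by omega),
            if_pos (show 2 * M + 1 < 2 * M + 2 by omega)]

/-! ### The two-point diagrams `P^{(N)}(x,y)` and Lemma 4.4 -/

/-- The two-point diagram `P^{(N)}(x,y)` of (4.16)–(4.21) with general factors `f₀, f₁, …`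
(for the self-avoiding walk `f = (H, H, G, H, G, …)`): `P^{(N)} = 0` for `N < 2`,
`P^{(2)}(x,y) = f₀(x) f₁(-x) f₂(y)` and
`P^{(N)}(x,y) = Σ_u P^{(N-1)}(u,x) f_{2N-3}(u - x) f_{2N-2}(y - u)` for `N ≥ 3`; `x` is the
position of the last marked point (where the diagram is to be closed), `y` the free endpoint.
[cite: Slade2006LaceExpansion, eqs. (4.16)–(4.21), Fig. 4.2] -/
def diagram (f : ℕ → Site d → ℝ≥0∞) : ℕ → Site d → Site d → ℝ≥0∞
  | 0 => fun _ _ => 0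
  | 1 => fun _ _ => 0
  | 2 => fun x y => f 0 x * f 1 (-x) * f 2 y
  | N + 3 => fun x y => ∑' u, diagram f (N + 2) u x * f (2 * N + 3) (u - x) * f (2 * N + 4) (y - u)

/-- The recursion unfolded at level `n + 3`. [folklore] -/
theorem diagram_succ (f : ℕ → Site d → ℝ≥0∞) (n : ℕ) (x y : Site d) :
    diagram f (n + 3) x y = ∑' u, diagram f (n + 2) u x * f (2 * n + 3) (u - x) * f (2 * n + 4) (y - u) :=
  rfl

/-- `P^{(N)}` depends only on `f₀, …, f_{2N-2}`. [folklore] -/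
theorem diagram_congr {f g : ℕ → Site d → ℝ≥0∞} :
    ∀ n, (∀ j ≤ 2 * n + 2, f j = g j) → diagram f (n + 2) = diagram g (n + 2)
  | 0, h => by
    funext x y
    simp only [diagram, h 0 (by omega), h 1 (by omega), h 2 (by omega)]
  | n + 1, h => by
    funext x y
    rw [diagram_succ, diagram_succ, diagram_congr n fun j hj => h j (by omega),
      h (2 * n + 3) (by omega), h (2 * n + 4) (by omega)]

/-- `P^{(N)}` is monotone in the factors. [folklore] -/
theorem diagram_mono {f g : ℕ → Site d → ℝ≥0∞} (h : ∀ j x, f j x ≤ g j x) :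
    ∀ n x y, diagram f (n + 2) x y ≤ diagram g (n + 2) x y
  | 0, x, y => by
    simp only [diagram]
    exact mul_le_mul' (mul_le_mul' (h _ _) (h _ _)) (h _ _)
  | n + 1, x, y => by
    rw [diagram_succ, diagram_succ]
    exact ENNReal.tsum_le_tsum fun u =>
      mul_le_mul' (mul_le_mul' (diagram_mono h n u x) (h _ _)) (h _ _)

/-- **Lemma 4.4** (Slade 2006): for even factors,
`Σ_x P^{(N)}(x, x + y) = [(ℋ'_{N-1} ℳ_{N-1} ⋯ ℋ'_1 ℳ_1) f₀](y)`, i.e.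
`Σ_x diagram f (n+2) x (x + y) = ladder f (n+1) y`. [cite: Slade2006LaceExpansion, Lemma 4.4] -/
theorem tsum_diagram_eq_ladder {f : ℕ → Site d → ℝ≥0∞} (hf : ∀ j, Function.Even (f j)) :
    ∀ (n : ℕ) (y : Site d), ∑' x, diagram f (n + 2) x (x + y) = ladder f (n + 1) y
  | 0, y => by
    simp only [diagram, ladder, econv]
    rw [← (Equiv.neg (Site d)).tsum_eq (fun x => f 0 x * f 1 (-x) * f 2 (x + y))]
    refine tsum_congr fun x => ?_
    simp only [Equiv.neg_apply, neg_neg, hf 0 x]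
    rw [mul_comm (f 0 x)]
    congr 1
    congr 1
    abel
  | n + 1, y => by
    have IH := tsum_diagram_eq_ladder hf n
    have IHe : Function.Even (ladder f (n + 1)) := even_ladder hf (n + 1)
    calc ∑' x, diagram f (n + 3) x (x + y)
        = ∑' x, ∑' u, diagram f (n + 2) u x * f (2 * n + 3) (u - x) * f (2 * n + 4) (x + y - u) := by
          simp only [diagram_succ]
      _ = ∑' u, ∑' x, diagram f (n + 2) u x * f (2 * n + 3) (u - x) * f (2 * n + 4) (x + y - u) :=
          ENNReal.tsum_comm
      _ = ∑' u, ∑' w, diagram f (n + 2) u (u + w) * f (2 * n + 3) (-w) * f (2 * n + 4) (y + w) := by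
          refine tsum_congr fun u => ?_
          rw [← (Equiv.addLeft u).tsum_eq (fun x => diagram f (n + 2) u x * f (2 * n + 3) (u - x) *
            f (2 * n + 4) (x + y - u))]
          refine tsum_congr fun w => ?_
          simp only [Equiv.coe_addLeft]
          congr 2
          · congr 1; abel
          · abel_nf
      _ = ∑' w, (∑' u, diagram f (n + 2) u (u + w)) * (f (2 * n + 3) (-w) * f (2 * n + 4) (y + w)) := by
          rw [ENNReal.tsum_comm]
          refine tsum_congr fun w => ?_
          rw [← ENNReal.tsum_mul_right]
          exact tsum_congr fun u => by ring
      _ = ∑' w, ladder f (n + 1) w * (f (2 * n + 3) (-w) * f (2 * n + 4) (y + w)) := by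
          simp only [IH]
      _ = ∑' w, ladder f (n + 1) w * (f (2 * n + 3) w * f (2 * n + 4) (y - w)) := by
          rw [← (Equiv.neg (Site d)).tsum_eq (fun w => ladder f (n + 1) w *
            (f (2 * n + 3) (-w) * f (2 * n + 4) (y + w)))]
          refine tsum_congr fun w => ?_
          simp only [Equiv.neg_apply, neg_neg, IHe w, sub_eq_add_neg]
      _ = ladder f (n + 2) y := by
          simp only [ladder, econv]
          refine tsum_congr fun w => ?_
          rw [show 2 * (n + 1) + 1 = 2 * n + 3 by ring, show 2 * (n + 1) + 2 = 2 * n + 4 by ring]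
          ring

/-- The bound of Theorem 4.1 **(4.9)** in abstract form ((4.40) + Lemma 4.6 with the sup norm on
`f₀`): for even factors, `Σ_x P^{(N)}(x,x) ≤ ‖f₀‖_∞ ∏_{j=1}^{N-1} ‖f_{2j-1} * f_{2j}‖_∞`.
[cite: Slade2006LaceExpansion, Theorem 4.1 (4.9), eq. (4.40)] -/
theorem tsum_diagram_le {f : ℕ → Site d → ℝ≥0∞} (hf : ∀ j, Function.Even (f j)) (n : ℕ) :
    ∑' x, diagram f (n + 2) x x ≤
      esup (f 0) * ∏ j ∈ range (n + 1), esup (econv (f (2 * j + 1)) (f (2 * j + 2))) := by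
  have h := tsum_diagram_eq_ladder hf n 0
  simp only [add_zero] at h
  rw [h]
  refine (le_esup _ 0).trans ((esup_ladder_le (n + 1) f hf 0 (by omega)).trans (le_of_eq ?_))
  simp [fanBound, skipIdx]

/-! ### The `[1 - cos(k·x)]`-weighted bound (4.10) -/

/-- The weight `[1 - cos(k·x)] ∈ [0, 2]` as an element of `ℝ≥0∞`.
[cite: Slade2006LaceExpansion, Theorem 4.1 (4.10)] -/
def cosWeight (k : Fin d → ℝ) (x : Site d) : ℝ≥0∞ := ENNReal.ofReal (1 - Real.cos (kdot k x))

/-- `[1 - cos(k·0)] = 0`. [folklore] -/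
@[simp] theorem cosWeight_zero (k : Fin d → ℝ) : cosWeight k 0 = 0 := by simp [cosWeight]

/-- The weight is even in `x`. [folklore] -/
theorem even_cosWeight (k : Fin d → ℝ) : Function.Even (cosWeight k) := by
  intro x
  simp only [cosWeight, kdot, Pi.neg_apply, Int.cast_neg, mul_neg, sum_neg_distrib, Real.cos_neg]

/-- `[1 - cos(k·x)] ≤ 2`. [folklore] -/
theorem cosWeight_le_two (k : Fin d → ℝ) (x : Site d) : cosWeight k x ≤ 2 := by
  unfold cosWeight
  rw [← ENNReal.ofReal_ofNat 2]
  exact ENNReal.ofReal_le_ofReal (by linarith [Real.neg_one_le_cos (kdot k x)])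

/-- Subadditivity up to a factor `2` (from `|1 - e^{i(s+t)}| ≤ |1 - e^{is}| + |1 - e^{it}|`, cf.
(4.47)–(4.50)): `1 - cos(k·(x+y)) ≤ 2[1 - cos(k·x)] + 2[1 - cos(k·y)]`.
[cite: Slade2006LaceExpansion, eqs. (4.47)–(4.50)] -/
theorem cosWeight_add_le (k : Fin d → ℝ) (x y : Site d) :
    cosWeight k (x + y) ≤ 2 * cosWeight k x + 2 * cosWeight k y := by
  unfold cosWeight
  have hkd : kdot k (x + y) = kdot k x + kdot k y := by
    simp only [kdot, Pi.add_apply, Int.cast_add, mul_add, sum_add_distrib]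
  rw [hkd, ← ENNReal.ofReal_ofNat 2, ← ENNReal.ofReal_mul zero_le_two,
    ← ENNReal.ofReal_mul zero_le_two, ← ENNReal.ofReal_add (by nlinarith [Real.cos_le_one (kdot k x)])
    (by nlinarith [Real.cos_le_one (kdot k y)])]
  refine ENNReal.ofReal_le_ofReal ?_
  set a := kdot k x
  set b := kdot k y
  rw [Real.cos_add]
  nlinarith [Real.sin_sq_add_cos_sq a, Real.sin_sq_add_cos_sq b,
    sq_nonneg (2 - Real.cos a - Real.cos b), sq_nonneg (Real.sin a - Real.sin b)]

/-- Inserting the weight `[1 - cos(k·x)]` on the factor `f_i`. [folklore] -/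
def weightAt (k : Fin d → ℝ) (f : ℕ → Site d → ℝ≥0∞) (i : ℕ) : ℕ → Site d → ℝ≥0∞ :=
  Function.update f i fun x => cosWeight k x * f i x

/-- Weighting preserves evenness. [folklore] -/
theorem even_weightAt (k : Fin d → ℝ) {f : ℕ → Site d → ℝ≥0∞} (hf : ∀ j, Function.Even (f j))
    (i j : ℕ) : Function.Even (weightAt k f i j) := by
  unfold weightAt
  by_cases hj : j = i
  · subst hj; rw [Function.update_self]; exact even_mul (even_cosWeight k) (hf j)
  · rw [Function.update_of_ne hj]; exact hf j

/-- The "spine endpoint" `Σ_i y_{4i-1}` of (4.46) for the open diagram `P^{(N)}(x,y)`: the free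
endpoint `y` if `N` is even, the marked point `x` if `N` is odd. [cite: Slade2006LaceExpansion, eq. (4.46)] -/
def spineEnd (N : ℕ) (x y : Site d) : Site d := if Even N then y else x

/-- For even `N` the spine ends at the free endpoint. [folklore] -/
theorem spineEnd_of_even {N : ℕ} (h : Even N) (x y : Site d) : spineEnd N x y = y := if_pos h

/-- For odd `N` the spine ends at the marked point. [folklore] -/
theorem spineEnd_of_odd {N : ℕ} (h : Odd N) (x y : Site d) : spineEnd N x y = x :=
  if_neg (Nat.not_even_iff_odd.2 h)

/-- `weightAt` leaves the other factors unchanged. [folklore] -/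
theorem weightAt_of_ne (k : Fin d → ℝ) (f : ℕ → Site d → ℝ≥0∞) {i j : ℕ} (h : j ≠ i) :
    weightAt k f i j = f j := Function.update_of_ne h _ _

/-- `weightAt` at the weighted index. [folklore] -/
theorem weightAt_self (k : Fin d → ℝ) (f : ℕ → Site d → ℝ≥0∞) (i : ℕ) (x : Site d) :
    weightAt k f i i x = cosWeight k x * f i x := by
  unfold weightAt; rw [Function.update_self]

/-- One recursion step of the diagram with a weight placed below the two new factors. [folklore] -/
theorem diagram_weightAt_succ (k : Fin d → ℝ) (f : ℕ → Site d → ℝ≥0∞) (n : ℕ) {i : ℕ}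
    (hi : i ≤ 2 * n + 2) (x y : Site d) :
    diagram (weightAt k f i) (n + 3) x y =
      ∑' u, diagram (weightAt k f i) (n + 2) u x * (f (2 * n + 3) (u - x) * f (2 * n + 4) (y - u)) := by
  rw [diagram_succ]
  refine tsum_congr fun u => ?_
  rw [weightAt_of_ne k f (by omega), weightAt_of_ne k f (by omega), mul_assoc]

/-- One recursion step of the diagram with the weight placed on the new last factor. [folklore] -/
theorem diagram_weightAt_last (k : Fin d → ℝ) (f : ℕ → Site d → ℝ≥0∞) (n : ℕ) (x y : Site d) :
    diagram (weightAt k f (2 * n + 4)) (n + 3) x y =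
      ∑' u, diagram f (n + 2) u x * f (2 * n + 3) (u - x) * (cosWeight k (y - u) * f (2 * n + 4) (y - u)) := by
  rw [diagram_succ, diagram_congr n (g := f) fun j hj => weightAt_of_ne k f (by omega)]
  refine tsum_congr fun u => ?_
  rw [weightAt_of_ne k f (by omega), weightAt_self]

/-- **The weighted diagram bound** (the mechanism of (4.44)–(4.51), with the telescoping (4.47)
replaced by iterating `cosWeight_add_le` along the pieces `I₃, I₇, …` of (4.46)): for `N ≥ 2`,
`[1 - cos(k·e_N(x,y))] P^{(N)}(x,y) ≤ 2^{⌊N/2⌋} Σ_{i=1}^{⌊N/2⌋} P^{(N)}[f with f_{4i-2} ↦ [1-cos(k·)] f_{4i-2}](x,y)`.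
[cite: Slade2006LaceExpansion, Theorem 4.1 (4.10), eqs. (4.44)–(4.51)] -/
theorem cosWeight_mul_diagram_le (k : Fin d → ℝ) :
    ∀ (n : ℕ) (f : ℕ → Site d → ℝ≥0∞) (x y : Site d),
      cosWeight k (spineEnd (n + 2) x y) * diagram f (n + 2) x y ≤
        2 ^ ((n + 2) / 2) * ∑ i ∈ Finset.Icc 1 ((n + 2) / 2), diagram (weightAt k f (4 * i - 2)) (n + 2) x y
  | 0, f, x, y => by
    -- `N = 2`: the weight sits on `f₂(y)` (equality up to the factor 2)
    show cosWeight k (spineEnd 2 x y) * diagram f 2 x y ≤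
      2 ^ 1 * ∑ i ∈ Finset.Icc 1 1, diagram (weightAt k f (4 * i - 2)) 2 x y
    rw [Finset.Icc_self, sum_singleton, pow_one, spineEnd_of_even even_two,
      show 4 * 1 - 2 = 2 from rfl]
    simp only [diagram]
    rw [weightAt_of_ne k f (show (0:ℕ) ≠ 2 by omega), weightAt_of_ne k f (show (1:ℕ) ≠ 2 by omega),
      weightAt_self]
    calc cosWeight k y * (f 0 x * f 1 (-x) * f 2 y) = f 0 x * f 1 (-x) * (cosWeight k y * f 2 y) := by
          ring
      _ ≤ 2 * (f 0 x * f 1 (-x) * (cosWeight k y * f 2 y)) := le_mul_of_one_le_left' one_le_two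
  | n + 1, f, x, y => by
    have IH := cosWeight_mul_diagram_le k n
    rcases Nat.even_or_odd n with hn | hn
    · -- `N = n + 3` odd: the spine endpoint is the marked point `x`, as at level `n + 2`
      obtain ⟨m, rfl⟩ := hn
      have hodd : Odd (m + m + 1 + 2) := ⟨m + 1, by ring⟩
      have heven : Even (m + m + 2) := ⟨m + 1, by ring⟩
      rw [show (m + m + 1 + 2) / 2 = m + 1 by omega, spineEnd_of_odd hodd]
      rw [show (m + m + 2) / 2 = m + 1 by omega] at IH
      calc cosWeight k x * diagram f (m + m + 1 + 2) x y
          = ∑' u, (cosWeight k (spineEnd (m + m + 2) u x) * diagram f (m + m + 2) u x) *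
              (f (2 * (m + m) + 3) (u - x) * f (2 * (m + m) + 4) (y - u)) := by
            rw [show m + m + 1 + 2 = m + m + 3 by ring, diagram_succ, ← ENNReal.tsum_mul_left]
            refine tsum_congr fun u => ?_
            rw [spineEnd_of_even heven]
            ring
        _ ≤ ∑' u, (2 ^ (m + 1) * ∑ i ∈ Finset.Icc 1 (m + 1), diagram (weightAt k f (4 * i - 2)) (m + m + 2) u x) *
              (f (2 * (m + m) + 3) (u - x) * f (2 * (m + m) + 4) (y - u)) :=
            ENNReal.tsum_le_tsum fun u => mul_le_mul' (IH f u x) le_rfl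
        _ = 2 ^ (m + 1) * ∑ i ∈ Finset.Icc 1 (m + 1), ∑' u, diagram (weightAt k f (4 * i - 2)) (m + m + 2) u x *
              (f (2 * (m + m) + 3) (u - x) * f (2 * (m + m) + 4) (y - u)) := by
            rw [← Summable.tsum_finsetSum (fun _ _ => ENNReal.summable), ← ENNReal.tsum_mul_left]
            refine tsum_congr fun u => ?_
            rw [mul_assoc, sum_mul]
        _ = 2 ^ (m + 1) * ∑ i ∈ Finset.Icc 1 (m + 1), diagram (weightAt k f (4 * i - 2)) (m + m + 1 + 2) x y := by
            congr 1
            refine sum_congr rfl fun i hi => ?_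
            rw [Finset.mem_Icc] at hi
            rw [show m + m + 1 + 2 = m + m + 3 by ring, diagram_weightAt_succ k f (m + m) (by omega)]
    · -- `N = n + 3` even: `e_N = y = u + (y - u)` with `u = e_{N-1}`; split the weight
      obtain ⟨m, rfl⟩ := hn
      have hevenN : Even (2 * m + 1 + 3) := ⟨m + 2, by ring⟩
      have hodd : Odd (2 * m + 1 + 2) := ⟨m + 1, by ring⟩
      rw [show 2 * m + 1 + 1 + 2 = 2 * m + 1 + 3 by ring, show (2 * m + 1 + 3) / 2 = m + 2 by omega,
        spineEnd_of_even hevenN]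
      rw [show (2 * m + 1 + 2) / 2 = m + 1 by omega] at IH
      have key : ∀ u, cosWeight k y ≤ 2 * cosWeight k (spineEnd (2 * m + 1 + 2) u x) + 2 * cosWeight k (y - u) := by
        intro u
        rw [spineEnd_of_odd hodd]
        have := cosWeight_add_le k u (y - u)
        rwa [add_sub_cancel] at this
      -- the two pieces of the bound, computed separately
      have hS : ∑' u, (2 ^ (m + 1) * ∑ i ∈ Finset.Icc 1 (m + 1), diagram (weightAt k f (4 * i - 2)) (2 * m + 1 + 2) u x) *
          (f (2 * (2 * m + 1) + 3) (u - x) * f (2 * (2 * m + 1) + 4) (y - u)) =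
          2 ^ (m + 1) * ∑ i ∈ Finset.Icc 1 (m + 1), diagram (weightAt k f (4 * i - 2)) (2 * m + 1 + 3) x y := by
        have h1 : ∀ i ∈ Finset.Icc 1 (m + 1), diagram (weightAt k f (4 * i - 2)) (2 * m + 1 + 3) x y =
            ∑' u, diagram (weightAt k f (4 * i - 2)) (2 * m + 1 + 2) u x *
              (f (2 * (2 * m + 1) + 3) (u - x) * f (2 * (2 * m + 1) + 4) (y - u)) := by
          intro i hi
          rw [Finset.mem_Icc] at hi
          rw [diagram_weightAt_succ k f (2 * m + 1) (by omega)]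
        rw [sum_congr rfl h1, ← Summable.tsum_finsetSum (fun _ _ => ENNReal.summable),
          ← ENNReal.tsum_mul_left]
        refine tsum_congr fun u => ?_
        rw [mul_assoc, sum_mul]
      have hT : ∑' u, diagram f (2 * m + 1 + 2) u x * f (2 * (2 * m + 1) + 3) (u - x) *
          (cosWeight k (y - u) * f (2 * (2 * m + 1) + 4) (y - u)) =
          diagram (weightAt k f (4 * (m + 2) - 2)) (2 * m + 1 + 3) x y := by
        rw [show 4 * (m + 2) - 2 = 2 * (2 * m + 1) + 4 by omega, diagram_weightAt_last]
      calc cosWeight k y * diagram f (2 * m + 1 + 3) x y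
          = ∑' u, cosWeight k y * (diagram f (2 * m + 1 + 2) u x * f (2 * (2 * m + 1) + 3) (u - x) *
              f (2 * (2 * m + 1) + 4) (y - u)) := by
            rw [diagram_succ, ← ENNReal.tsum_mul_left]
        _ ≤ ∑' u, (2 * cosWeight k (spineEnd (2 * m + 1 + 2) u x) + 2 * cosWeight k (y - u)) *
              (diagram f (2 * m + 1 + 2) u x * f (2 * (2 * m + 1) + 3) (u - x) *
                f (2 * (2 * m + 1) + 4) (y - u)) :=
            ENNReal.tsum_le_tsum fun u => mul_le_mul' (key u) le_rfl
        _ = 2 * ∑' u, (cosWeight k (spineEnd (2 * m + 1 + 2) u x) * diagram f (2 * m + 1 + 2) u x) *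
                (f (2 * (2 * m + 1) + 3) (u - x) * f (2 * (2 * m + 1) + 4) (y - u)) +
              2 * ∑' u, diagram f (2 * m + 1 + 2) u x * f (2 * (2 * m + 1) + 3) (u - x) *
                (cosWeight k (y - u) * f (2 * (2 * m + 1) + 4) (y - u)) := by
            rw [← ENNReal.tsum_mul_left, ← ENNReal.tsum_mul_left, ← ENNReal.tsum_add]
            refine tsum_congr fun u => ?_
            ring
        _ ≤ 2 * ∑' u, (2 ^ (m + 1) * ∑ i ∈ Finset.Icc 1 (m + 1),
                  diagram (weightAt k f (4 * i - 2)) (2 * m + 1 + 2) u x) *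
                (f (2 * (2 * m + 1) + 3) (u - x) * f (2 * (2 * m + 1) + 4) (y - u)) +
              2 * ∑' u, diagram f (2 * m + 1 + 2) u x * f (2 * (2 * m + 1) + 3) (u - x) *
                (cosWeight k (y - u) * f (2 * (2 * m + 1) + 4) (y - u)) := by
            exact add_le_add (mul_le_mul' le_rfl (ENNReal.tsum_le_tsum fun u =>
              mul_le_mul' (IH f u x) le_rfl)) le_rfl
        _ = 2 * 2 ^ (m + 1) * ∑ i ∈ Finset.Icc 1 (m + 1), diagram (weightAt k f (4 * i - 2)) (2 * m + 1 + 3) x y +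
              2 * diagram (weightAt k f (4 * (m + 2) - 2)) (2 * m + 1 + 3) x y := by
            rw [hS, hT, mul_assoc]
        _ ≤ 2 ^ (m + 2) * ∑ i ∈ Finset.Icc 1 (m + 1), diagram (weightAt k f (4 * i - 2)) (2 * m + 1 + 3) x y +
              2 ^ (m + 2) * diagram (weightAt k f (4 * (m + 2) - 2)) (2 * m + 1 + 3) x y := by
            have h2 : (2 : ℝ≥0∞) * 2 ^ (m + 1) = 2 ^ (m + 2) := by ring
            have h3 : (2 : ℝ≥0∞) ≤ 2 ^ (m + 2) := by
              calc (2 : ℝ≥0∞) = 2 ^ 1 := (pow_one _).symm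
                _ ≤ 2 ^ (m + 2) := pow_le_pow_right' one_le_two (by omega)
            rw [h2]
            exact add_le_add le_rfl (mul_le_mul' h3 le_rfl)
        _ = 2 ^ (m + 2) * ∑ i ∈ Finset.Icc 1 (m + 2), diagram (weightAt k f (4 * i - 2)) (2 * m + 1 + 3) x y := by
            rw [Finset.sum_Icc_succ_top (by omega : 1 ≤ m + 1 + 1), mul_add (2 ^ (m + 2))]

/-- The bound of Theorem 4.1 **(4.10)** in abstract form: for even factors and `N ≥ 2`,
`Σ_x [1 - cos(k·x)] P^{(N)}(x,x) ≤ 2^{⌊N/2⌋} Σ_{i=1}^{⌊N/2⌋} ‖[1 - cos(k·)] f_{4i-2}‖_∞ ∏ ‖f_j * f_{j'}‖_∞`,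
the product over the consecutive disjoint pairs of `{0,…,2N-2} ∖ {4i-2}` (Slade's (4.10) has the
constant `(N+1)⌊N/2⌋` in place of `2^{⌊N/2⌋} ⌊N/2⌋`, immaterial for (5.47)).
[cite: Slade2006LaceExpansion, Theorem 4.1 (4.10)] -/
theorem tsum_cosWeight_mul_diagram_le {f : ℕ → Site d → ℝ≥0∞} (hf : ∀ j, Function.Even (f j))
    (k : Fin d → ℝ) (n : ℕ) :
    ∑' x, cosWeight k x * diagram f (n + 2) x x ≤
      2 ^ ((n + 2) / 2) * ∑ i ∈ Finset.Icc 1 ((n + 2) / 2), fanBound (weightAt k f (4 * i - 2)) (4 * i - 2) (n + 1) := by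
  have hspine : ∀ x : Site d, spineEnd (n + 2) x x = x := fun x => by
    unfold spineEnd; split_ifs <;> rfl
  calc ∑' x, cosWeight k x * diagram f (n + 2) x x
      ≤ ∑' x, 2 ^ ((n + 2) / 2) * ∑ i ∈ Finset.Icc 1 ((n + 2) / 2),
          diagram (weightAt k f (4 * i - 2)) (n + 2) x x := by
        refine ENNReal.tsum_le_tsum fun x => ?_
        have := cosWeight_mul_diagram_le k n f x x
        rwa [hspine] at this
    _ = 2 ^ ((n + 2) / 2) * ∑ i ∈ Finset.Icc 1 ((n + 2) / 2),
          ∑' x, diagram (weightAt k f (4 * i - 2)) (n + 2) x x := by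
        rw [ENNReal.tsum_mul_left, Summable.tsum_finsetSum (fun _ _ => ENNReal.summable)]
    _ ≤ _ := by
        gcongr with i hi
        rw [Finset.mem_Icc] at hi
        have h := tsum_diagram_eq_ladder (even_weightAt k hf (4 * i - 2)) n 0
        simp only [add_zero] at h
        rw [h]
        exact (le_esup _ 0).trans (esup_ladder_le (n + 1) _ (even_weightAt k hf _) _ (by omega))

/-! ### Specialisation to factor lists of the self-avoiding-walk type `(·, A, ·, A, ·, A, …)` -/

section TwoFunctions

variable {f : ℕ → Site d → ℝ≥0∞} {A B : Site d → ℝ≥0∞}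

/-- If every odd-indexed factor is `A` and every factor is `≤ B`, each consecutive pair convolves to
at most `‖A * B‖_∞`. [folklore] -/
theorem esup_econv_pair_le (hA : ∀ j, f (2 * j + 1) = A) (hB : ∀ j x, f j x ≤ B x) (j : ℕ) :
    esup (econv (f (2 * j)) (f (2 * j + 1))) ≤ esup (econv A B) ∧
      esup (econv (f (2 * j + 1)) (f (2 * j + 2))) ≤ esup (econv A B) := by
  constructor
  · rw [hA j]
    refine esup_mono fun x => ?_
    rw [econv_comm]
    exact econv_mono (fun _ => le_rfl) (hB _) x
  · rw [hA j]
    exact esup_mono (econv_mono (fun _ => le_rfl) (hB _))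

/-- **(4.9) for SAW-type factor lists**: if `f_{2j+1} = A` for all `j` and `f_j ≤ B` for all `j`
(for the self-avoiding walk `A = H_z`, `B = G_z`), then
`Σ_x P^{(N)}(x,x) ≤ ‖f₀‖_∞ ‖A * B‖_∞^{N-1}`. [cite: Slade2006LaceExpansion, Theorem 4.1 (4.9)] -/
theorem tsum_diagram_le_pow (hf : ∀ j, Function.Even (f j)) (hA : ∀ j, f (2 * j + 1) = A)
    (hB : ∀ j x, f j x ≤ B x) (n : ℕ) :
    ∑' x, diagram f (n + 2) x x ≤ esup (f 0) * esup (econv A B) ^ (n + 1) := by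
  refine (tsum_diagram_le hf n).trans (mul_le_mul' le_rfl ?_)
  refine (Finset.prod_le_pow_card _ _ _ fun j _ => (esup_econv_pair_le hA hB j).2).trans_eq ?_
  rw [card_range]

/-- The fan bound with the weight at `4i - 2` (`i ≥ 1`), for SAW-type factor lists:
`≤ ‖[1 - cos(k·)] f_{4i-2}‖_∞ ‖A * B‖_∞^M`. [folklore] -/
theorem fanBound_weightAt_le (hA : ∀ j, f (2 * j + 1) = A) (hB : ∀ j x, f j x ≤ B x)
    (k : Fin d → ℝ) {i : ℕ} (hi : 1 ≤ i) (M : ℕ) :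
    fanBound (weightAt k f (4 * i - 2)) (4 * i - 2) M ≤
      esup (fun x => cosWeight k x * f (4 * i - 2) x) * esup (econv A B) ^ M := by
  unfold fanBound
  refine mul_le_mul' (le_of_eq ?_) ?_
  · congr 1
    funext x
    exact weightAt_self k f _ x
  · refine (Finset.prod_le_pow_card _ _ _ fun j _ => ?_).trans_eq (by rw [card_range])
    by_cases hj : 2 * j + 1 < 4 * i - 2
    · simp only [skipIdx, if_pos (show 2 * j < 4 * i - 2 by omega), if_pos hj]
      rw [weightAt_of_ne k f (by omega), weightAt_of_ne k f (by omega)]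
      exact (esup_econv_pair_le hA hB j).1
    · have hj' : ¬ 2 * j < 4 * i - 2 := by omega
      simp only [skipIdx, if_neg hj', if_neg hj]
      rw [weightAt_of_ne k f (by omega), weightAt_of_ne k f (by omega)]
      exact (esup_econv_pair_le hA hB j).2

/-- **(4.10) for SAW-type factor lists**: if `f_{2j+1} = A` and `f_j ≤ B` for all `j`, then for
`N = n + 2 ≥ 2`,
`Σ_x [1 - cos(k·x)] P^{(N)}(x,x) ≤ 2^{⌊N/2⌋} ⌊N/2⌋ ‖[1 - cos(k·x)] B(x)‖_∞ ‖A * B‖_∞^{N-1}`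
(Slade: `(N+1)⌊N/2⌋ ‖[1-cos(k·x)] H_z(x)‖_∞ ‖H_z * G_z‖_∞^{N-1}`; note `[1-cos(k·x)]G_z(x) = [1-cos(k·x)]H_z(x)`).
[cite: Slade2006LaceExpansion, Theorem 4.1 (4.10)] -/
theorem tsum_cosWeight_mul_diagram_le_pow (hf : ∀ j, Function.Even (f j)) (hA : ∀ j, f (2 * j + 1) = A)
    (hB : ∀ j x, f j x ≤ B x) (k : Fin d → ℝ) (n : ℕ) :
    ∑' x, cosWeight k x * diagram f (n + 2) x x ≤
      2 ^ ((n + 2) / 2) * ((n + 2) / 2 : ℕ) * (esup (fun x => cosWeight k x * B x) * esup (econv A B) ^ (n + 1)) := by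
  refine (tsum_cosWeight_mul_diagram_le hf k n).trans ?_
  rw [mul_assoc]
  refine mul_le_mul' le_rfl ?_
  calc ∑ i ∈ Finset.Icc 1 ((n + 2) / 2), fanBound (weightAt k f (4 * i - 2)) (4 * i - 2) (n + 1)
      ≤ (Finset.Icc 1 ((n + 2) / 2)).card •
          (esup (fun x => cosWeight k x * B x) * esup (econv A B) ^ (n + 1)) := by
        refine Finset.sum_le_card_nsmul _ _ _ fun i hi => ?_
        rw [Finset.mem_Icc] at hi
        refine (fanBound_weightAt_le hA hB k hi.1 (n + 1)).trans
          (mul_le_mul' (esup_mono fun x => ?_) le_rfl)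
        exact mul_le_mul' le_rfl (hB _ x)
    _ = _ := by rw [Nat.card_Icc, Nat.add_sub_cancel, nsmul_eq_mul]

end TwoFunctions

end LaceExpansion

end Literature.Barriers.CriticalPhenomena
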